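import Summits.BirchSwinnertonDyer.BirchSwinnertonDyer.Theorems.PrintX8VSPublishedInputsX8CoreSlimPoitouTateSha
import Summits.BirchSwinnertonDyer.BirchSwinnertonDyer.Theorems.SignedLowerHalvesSharpFlatCharValueRankZeroAllLevelsOfPoitouTateSha
import Summits.BirchSwinnertonDyer.BirchSwinnertonDyer.Theorems.ThetaPartnerAtTwoSignedControlAtTwoStubPoitouTateShaRat
import Summits.BirchSwinnertonDyer.BirchSwinnertonDyer.Theses.PrintX8
import HarnessLib

set_option linter.dupNamespace false -- `…BirchSwinnertonDyer.BirchSwinnertonDyer…` is the cell's nested layout (D-0017)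
set_option autoImplicit false

/-!
# F16 — Sprung 2024 Lemma 5.9 at all levels (`Sprung2024.lem59AllN_sharpFlatCharValue_rankZero`, item 19878) is a THEOREM OF THE
# TREE: the ♯/♭ characteristic-value formula in analytic rank 0, every level, UNCONDITIONAL — with Lemma 5.5 (all `N`, cardinality form)
# and Lemma 5.9 (top level) (LADDER-BSD D-0154 (2), INPUTS-LIST-2 rows 6–8; routes `SignedLowerHalves` / `PrintX8VS` / `PrintX8`)

Seat `bsd-inputs-honda-p1` (gen 6, idle INPUTS prover of the desk `pub/bsd-wall/bsd-inputs`), `--workitem` stmt-BirchSwinnertonDyer-19878.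
THEOREMS ONLY (no definition, no named fact, no `sorry`); no new mathematics — compositions of landed doors.

The chain (all landed): l55-p1 / k4-p1 proved the doors `SharpFlatCount.lem55AllN/lem59AllN/lem59_of_poitouTate (hPTs : PT-Sel ℚ) (hPT : PT-Ш ℚ)`
(T1, p618145: Greenberg 1999 engine for the ♯/♭ Selmer groups, Cassels from Poitou–Tate, `Ш² = 0` at odd supersingular `p`, the ♯/♭ local
condition from the Honda system of Sprung 2012 Thm. 2.2 proved by honda-p1 g0, Sprung 2024 Props. 7.3/7.6); T13a (p626930, this seat)
discharged PT-Sel by bsd-schneider's `poitouTate_selmerStructure_duality_holds`; and PT-Ш is, since 2026-08-28T11:36Z, a THEOREM for every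
number field: `SignedEC.PoitouTateShaRat.poitouTate_sha_tateDual_numberField (K)` (bsd-wall K4, k4-p1 g0, p629917; item 20462 closed by chl-p2
g7, p630237). Hence the three named facts hold with NO hypothesis (§1), and the route declarations carrying item 19878
(`SignedLowerHalves.SharpFlatCharValueRankZeroAllLevels`, `PrintX8VS.InputLem59AllN`, `PrintX8.InputLem59AllN`; all `def … : Prop :=` aliases)
follow by `exact` (§2).

Honest framing: F16 is a published theorem (F. Sprung, 2024, Lemma 5.9 / §5.2, with Lemma 5.5) whose in-tree proof was conditional only on
the two classical Poitou–Tate inputs; both are now kernel theorems, so F16 is UNCONDITIONAL AS TYPED. Closing item 19878 removes one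
displayed print input of `PrintX8VS` / `PrintX8` / `SignedLowerHalves` (pack 23004 then displays its four E-specific prints only); it is NOT
a case of BSD, no crux of substance and no summit statement is proved, and the Birch–Swinnerton-Dyer conjecture is NOT proved by any of this.
References: [Sprung2024] Lemmas 5.5, 5.9, §5.2, Props. 7.3, 7.6; [GreenbergLNM1716] §4; [MilneADT2006] Ch. I, Thm. 4.10; [Sprung2012] Thm. 2.2.
-/

noncomputable section

namespace Summit.BirchSwinnertonDyer.BirchSwinnertonDyer.Theorems.SharpFlatCount

open Literature.NumberTheory.GaloisCohomology Literature.NumberTheory.EllipticCurves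

/-! ## §1 The named facts, hypothesis-free -/

/-- **Sprung 2024 Lemma 5.5 at all levels, cardinality form — the named fact `Sprung2024.lem55AllN_sharpFlat_coinvariants_card`, PROVED
(no hypothesis):** `lem55AllN_of_poitouTateSha` at `SignedEC.PoitouTateShaRat.poitouTate_sha_tateDual_numberField ℚ`. Unconditional; BSD is
not proved by this. [cite: Sprung2024, Lemma 5.5] [cite: MilneADT2006, Ch. I, Thm. 4.10 (a)(b)] -/
theorem lem55AllN_sharpFlat_coinvariants_card_holds : Sprung2024.lem55AllN_sharpFlat_coinvariants_card :=
  lem55AllN_of_poitouTateSha (SignedEC.PoitouTateShaRat.poitouTate_sha_tateDual_numberField ℚ)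

/-- **Sprung 2024 Lemma 5.9 at all levels (F16) — the named fact `Sprung2024.lem59AllN_sharpFlatCharValue_rankZero` (item 19878's
signature), PROVED (no hypothesis):** `lem59AllN_of_poitouTateSha` at `SignedEC.PoitouTateShaRat.poitouTate_sha_tateDual_numberField ℚ`.
Unconditional; BSD is not proved by this. [cite: Sprung2024, Lemma 5.9] [cite: MilneADT2006, Ch. I, Thm. 4.10 (a)(b)] -/
theorem lem59AllN_sharpFlatCharValue_rankZero_holds : Sprung2024.lem59AllN_sharpFlatCharValue_rankZero :=
  lem59AllN_of_poitouTateSha (SignedEC.PoitouTateShaRat.poitouTate_sha_tateDual_numberField ℚ)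

/-- **Sprung 2024 Lemma 5.9, top level — the named fact `Sprung2024.lem59_sharpFlatCharValue_rankZero`, PROVED (no hypothesis):**
`lem59_of_poitouTateSha` at `…poitouTate_sha_tateDual_numberField ℚ`. Unconditional; BSD is not proved by this. [cite: Sprung2024, Lemma 5.9, §5.2]
[cite: MilneADT2006, Ch. I, Thm. 4.10 (a)(b)] -/
theorem lem59_sharpFlatCharValue_rankZero_holds : Sprung2024.lem59_sharpFlatCharValue_rankZero :=
  lem59_of_poitouTateSha (SignedEC.PoitouTateShaRat.poitouTate_sha_tateDual_numberField ℚ)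

/-! ## §2 Item 19878 on its three routes, by name -/

/-- **Route `SignedLowerHalves`, support `SharpFlatCharValueRankZeroAllLevels` (item 19878) — PROVED (by name).** Unconditional; closes item
19878; BSD is not proved by this. [cite: Sprung2024, Lemma 5.9] [cite: MilneADT2006, Ch. I, Thm. 4.10] -/
theorem signedLowerHalves_sharpFlatCharValueRankZeroAllLevels_proof :
    Summit.BirchSwinnertonDyer.BirchSwinnertonDyer.Theses.SignedLowerHalves.SharpFlatCharValueRankZeroAllLevels := by
  unfold Summit.BirchSwinnertonDyer.BirchSwinnertonDyer.Theses.SignedLowerHalves.SharpFlatCharValueRankZeroAllLevels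
  exact lem59AllN_sharpFlatCharValue_rankZero_holds

/-- **Route `PrintX8VS`, child `InputLem59AllN` (the same item 19878) — PROVED (by name).** Unconditional; BSD is not proved by this.
[cite: Sprung2024, Lemma 5.9] [cite: MilneADT2006, Ch. I, Thm. 4.10] -/
theorem printX8VS_inputLem59AllN_proof :
    Summit.BirchSwinnertonDyer.BirchSwinnertonDyer.Theses.PrintX8VS.InputLem59AllN := by
  unfold Summit.BirchSwinnertonDyer.BirchSwinnertonDyer.Theses.PrintX8VS.InputLem59AllN
  exact lem59AllN_sharpFlatCharValue_rankZero_holds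

/-- **Route `PrintX8`, child `InputLem59AllN` (the same item 19878) — PROVED (by name).** Unconditional; BSD is not proved by this.
[cite: Sprung2024, Lemma 5.9] [cite: MilneADT2006, Ch. I, Thm. 4.10] -/
theorem printX8_inputLem59AllN_proof :
    Summit.BirchSwinnertonDyer.BirchSwinnertonDyer.Theses.PrintX8.InputLem59AllN := by
  unfold Summit.BirchSwinnertonDyer.BirchSwinnertonDyer.Theses.PrintX8.InputLem59AllN
  exact lem59AllN_sharpFlatCharValue_rankZero_holds

end Summit.BirchSwinnertonDyer.BirchSwinnertonDyer.Theorems.SharpFlatCount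

end
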